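import Mathlib
import HarnessLib

/-!
# `DigitPolyUniformity`, line `Sketch` (cycle 6, bottom-end chirps) — Stub A: the 2-adic logarithm

For `k ≥ 2` the odd residues modulo `2^k` are exactly the `± 5^t`, `t mod 2^(k-2)`
(`(ℤ/2^k)ˣ = {±1} × ⟨5⟩` with `⟨5⟩` cyclic of order `2^(k-2)`; Mathlib `ZMod.orderOf_five`).
`stub_ind` packages this structure as a function `ind : ℕ → ℕ`: bounded by `2^(k-2)`,
`2^k`-periodic, `u ≡ ±5^(ind u) (mod 2^k)` for odd `u`, additive on products of odd numbers, and
mapping each odd class modulo `2^j` below `2^k` bijectively onto a progression modulo `2^(j-2)`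
below `2^(k-2)` (stated as an equality of sums) — the five properties consumed by
`Chirp.exists_chirp`.

Throughout, "`u ≡ ±5^t (mod M)`" is spelled `u % M = 5 ^ t % M ∨ (u + 5 ^ t) % M = 0`, exactly as
in the statement of `stub_ind`; the sign is read off from `u mod 4` (as `5^t ≡ 1 (mod 4)`), and the
exponent is pinned down by `ZMod.orderOf_five`.  Existence of the logarithm is a counting argument:
`(ε, t) ↦ ε·5^t`, `{±1} × [0, 2^n) → (ℤ/2^(n+2))ˣ`, is injective between sets of size `2^(n+1)`.
-/

noncomputable section

namespace Summit.QuantumAdvantage.DigitPolyUniformity.SketchLAR.Chirp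

open Finset

/-! ### Arithmetic of `5^t` modulo powers of two -/

/-- `5^t ≡ 1 (mod 4)`. [folklore] -/
theorem twoAdicLog_five_pow_mod_four (t : ℕ) : 5 ^ t % 4 = 1 := by
  rw [Nat.pow_mod]
  norm_num

/-- `4 ∣ 2^(i+2)`. [folklore] -/
theorem twoAdicLog_four_dvd (i : ℕ) : 4 ∣ 2 ^ (i + 2) := ⟨2 ^ i, by ring⟩

/-- `u ≡ 5^t (mod 2^(i+2))` forces `u ≡ 1 (mod 4)`. [folklore] -/
theorem twoAdicLog_mod_four_of_plus {i u t : ℕ} (h : u % 2 ^ (i + 2) = 5 ^ t % 2 ^ (i + 2)) :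
    u % 4 = 1 := by
  rw [← Nat.mod_mod_of_dvd u (twoAdicLog_four_dvd i), h,
    Nat.mod_mod_of_dvd _ (twoAdicLog_four_dvd i), twoAdicLog_five_pow_mod_four]

/-- `u ≡ -5^t (mod 2^(i+2))` forces `u ≡ 3 (mod 4)`. [folklore] -/
theorem twoAdicLog_mod_four_of_minus {i u t : ℕ} (h : (u + 5 ^ t) % 2 ^ (i + 2) = 0) :
    u % 4 = 3 := by
  have h1 := twoAdicLog_five_pow_mod_four t
  have h2 : (u + 5 ^ t) % 4 = 0 := by rw [← Nat.mod_mod_of_dvd _ (twoAdicLog_four_dvd i), h]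
  omega

/-- A residue `≡ ±5^t (mod 2^(i+2))` is odd. [folklore] -/
theorem twoAdicLog_odd_of_pm {i u t : ℕ}
    (hu : u % 2 ^ (i + 2) = 5 ^ t % 2 ^ (i + 2) ∨ (u + 5 ^ t) % 2 ^ (i + 2) = 0) : Odd u := by
  rw [Nat.odd_iff]
  rcases hu with hu | hu
  · have := twoAdicLog_mod_four_of_plus hu
    omega
  · have := twoAdicLog_mod_four_of_minus hu
    omega

/-- Bridge to `ZMod`: `u ≡ 5^t (mod M)` iff `u = 5^t` in `ZMod M`. [folklore] -/
theorem twoAdicLog_plus_iff (M u t : ℕ) : u % M = 5 ^ t % M ↔ (u : ZMod M) = 5 ^ t := by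
  rw [← ZMod.natCast_eq_natCast_iff', Nat.cast_pow, Nat.cast_ofNat]

/-- Bridge to `ZMod`: `u ≡ -5^t (mod M)` iff `u = -5^t` in `ZMod M`. [folklore] -/
theorem twoAdicLog_minus_iff (M u t : ℕ) : (u + 5 ^ t) % M = 0 ↔ (u : ZMod M) = -5 ^ t := by
  rw [eq_neg_iff_add_eq_zero, ← Nat.dvd_iff_mod_eq_zero, ← ZMod.natCast_eq_zero_iff,
    Nat.cast_add, Nat.cast_pow, Nat.cast_ofNat]

/-- `5^t = 5^t'` in `ZMod (2^(i+2))` iff `t ≡ t' (mod 2^i)` (Mathlib `ZMod.orderOf_five`).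
[folklore] -/
theorem twoAdicLog_five_pow_eq_iff (i t t' : ℕ) :
    (5 : ZMod (2 ^ (i + 2))) ^ t = 5 ^ t' ↔ t % 2 ^ i = t' % 2 ^ i := by
  have h5 : IsOfFinOrder (5 : ZMod (2 ^ (i + 2))) :=
    orderOf_pos_iff.mp (by rw [ZMod.orderOf_five]; positivity)
  rw [h5.pow_inj_mod, ZMod.orderOf_five]

/-- `-1 ∉ ⟨5⟩` modulo `2^(i+2)`: `5^t ≠ -5^t'` (reduce modulo `4`). [folklore] -/
theorem twoAdicLog_five_pow_ne_neg (i t t' : ℕ) : (5 : ZMod (2 ^ (i + 2))) ^ t ≠ -5 ^ t' := by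
  intro h
  have h' : ((5 ^ t : ℕ) : ZMod (2 ^ (i + 2))) = -5 ^ t' := by rw [Nat.cast_pow, Nat.cast_ofNat, h]
  have h3 := twoAdicLog_mod_four_of_minus ((twoAdicLog_minus_iff _ _ _).mpr h')
  rw [twoAdicLog_five_pow_mod_four] at h3
  omega

/-! ### Comparing two residues `u ≡ ±5^t`, `u' ≡ ±5^t'` -/

/-- Residues `≡ ±5^t`, `≡ ±5^t'` that agree modulo `2^(i+2)` have `t ≡ t' (mod 2^i)`. [folklore] -/
theorem twoAdicLog_log_congr {i u u' t t' : ℕ}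
    (hu : u % 2 ^ (i + 2) = 5 ^ t % 2 ^ (i + 2) ∨ (u + 5 ^ t) % 2 ^ (i + 2) = 0)
    (hu' : u' % 2 ^ (i + 2) = 5 ^ t' % 2 ^ (i + 2) ∨ (u' + 5 ^ t') % 2 ^ (i + 2) = 0)
    (h : u % 2 ^ (i + 2) = u' % 2 ^ (i + 2)) : t % 2 ^ i = t' % 2 ^ i := by
  have h4 : u % 4 = u' % 4 := by
    rw [← Nat.mod_mod_of_dvd u (twoAdicLog_four_dvd i), h,
      Nat.mod_mod_of_dvd _ (twoAdicLog_four_dvd i)]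
  have hz : (u : ZMod (2 ^ (i + 2))) = u' := (ZMod.natCast_eq_natCast_iff' _ _ _).mpr h
  rcases hu with hu | hu <;> rcases hu' with hu' | hu'
  · rw [twoAdicLog_plus_iff] at hu hu'
    rw [← twoAdicLog_five_pow_eq_iff, ← hu, ← hu', hz]
  · have := twoAdicLog_mod_four_of_plus hu
    have := twoAdicLog_mod_four_of_minus hu'
    omega
  · have := twoAdicLog_mod_four_of_minus hu
    have := twoAdicLog_mod_four_of_plus hu'
    omega
  · rw [twoAdicLog_minus_iff] at hu hu'
    rw [← twoAdicLog_five_pow_eq_iff, ← neg_inj, ← hu, ← hu', hz]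

/-- Residues `≡ ±5^t`, `≡ ±5^t'` with `t ≡ t' (mod 2^i)` and the same sign (the same residue
modulo `4`) agree modulo `2^(i+2)`. [folklore] -/
theorem twoAdicLog_res_congr {i u u' t t' : ℕ}
    (hu : u % 2 ^ (i + 2) = 5 ^ t % 2 ^ (i + 2) ∨ (u + 5 ^ t) % 2 ^ (i + 2) = 0)
    (hu' : u' % 2 ^ (i + 2) = 5 ^ t' % 2 ^ (i + 2) ∨ (u' + 5 ^ t') % 2 ^ (i + 2) = 0)
    (ht : t % 2 ^ i = t' % 2 ^ i) (h4 : u % 4 = u' % 4) :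
    u % 2 ^ (i + 2) = u' % 2 ^ (i + 2) := by
  rw [← twoAdicLog_five_pow_eq_iff] at ht
  rw [← ZMod.natCast_eq_natCast_iff']
  rcases hu with hu | hu <;> rcases hu' with hu' | hu'
  · rw [twoAdicLog_plus_iff] at hu hu'
    rw [hu, hu', ht]
  · have := twoAdicLog_mod_four_of_plus hu
    have := twoAdicLog_mod_four_of_minus hu'
    omega
  · have := twoAdicLog_mod_four_of_minus hu
    have := twoAdicLog_mod_four_of_plus hu'
    omega
  · rw [twoAdicLog_minus_iff] at hu hu'
    rw [hu, hu', ht]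

/-- Uniqueness of the logarithm below `2^n`. [folklore] -/
theorem twoAdicLog_unique {n u t t' : ℕ} (ht : t < 2 ^ n) (ht' : t' < 2 ^ n)
    (hu : u % 2 ^ (n + 2) = 5 ^ t % 2 ^ (n + 2) ∨ (u + 5 ^ t) % 2 ^ (n + 2) = 0)
    (hu' : u % 2 ^ (n + 2) = 5 ^ t' % 2 ^ (n + 2) ∨ (u + 5 ^ t') % 2 ^ (n + 2) = 0) : t = t' := by
  have h := twoAdicLog_log_congr hu hu' rfl
  rwa [Nat.mod_eq_of_lt ht, Nat.mod_eq_of_lt ht'] at h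

/-- Reduction of `u ≡ ±5^t` from modulus `2^(n+2)` to modulus `2^(i+2)`, `i ≤ n`. [folklore] -/
theorem twoAdicLog_pm_reduce {n i u t : ℕ} (hi : i ≤ n)
    (hu : u % 2 ^ (n + 2) = 5 ^ t % 2 ^ (n + 2) ∨ (u + 5 ^ t) % 2 ^ (n + 2) = 0) :
    u % 2 ^ (i + 2) = 5 ^ t % 2 ^ (i + 2) ∨ (u + 5 ^ t) % 2 ^ (i + 2) = 0 := by
  have hd : 2 ^ (i + 2) ∣ 2 ^ (n + 2) := pow_dvd_pow 2 (by omega)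
  rcases hu with hu | hu
  · left
    rw [← Nat.mod_mod_of_dvd u hd, hu, Nat.mod_mod_of_dvd _ hd]
  · right
    rw [← Nat.mod_mod_of_dvd _ hd, hu, Nat.zero_mod]

/-- Changing the exponent within its class modulo `2^i` preserves `u ≡ ±5^t (mod 2^(i+2))`.
[folklore] -/
theorem twoAdicLog_pm_exp_congr {i u t t' : ℕ} (ht : t % 2 ^ i = t' % 2 ^ i)
    (hu : u % 2 ^ (i + 2) = 5 ^ t % 2 ^ (i + 2) ∨ (u + 5 ^ t) % 2 ^ (i + 2) = 0) :
    u % 2 ^ (i + 2) = 5 ^ t' % 2 ^ (i + 2) ∨ (u + 5 ^ t') % 2 ^ (i + 2) = 0 := by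
  rw [← twoAdicLog_five_pow_eq_iff] at ht
  rw [twoAdicLog_plus_iff, twoAdicLog_minus_iff] at hu ⊢
  rw [← ht]
  exact hu

/-- Products: `u ≡ ±5^a`, `v ≡ ±5^b` give `u v ≡ ±5^(a+b)`. [folklore] -/
theorem twoAdicLog_pm_mul {M u v a b : ℕ}
    (hu : u % M = 5 ^ a % M ∨ (u + 5 ^ a) % M = 0)
    (hv : v % M = 5 ^ b % M ∨ (v + 5 ^ b) % M = 0) :
    u * v % M = 5 ^ (a + b) % M ∨ (u * v + 5 ^ (a + b)) % M = 0 := by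
  rw [twoAdicLog_plus_iff, twoAdicLog_minus_iff] at hu hv ⊢
  rw [Nat.cast_mul, pow_add]
  rcases hu with hu | hu <;> rcases hv with hv | hv
  · left
    rw [hu, hv]
  · right
    rw [hu, hv, mul_neg]
  · right
    rw [hu, hv, neg_mul]
  · left
    rw [hu, hv, neg_mul_neg]

/-- The representative `(M-1)·X mod M` of `-X`: `((M-1)·X mod M) + X ≡ 0 (mod M)`. [folklore] -/
theorem twoAdicLog_rep_minus (M X : ℕ) (hM : 0 < M) : ((M - 1) * X % M + X) % M = 0 := by
  obtain ⟨M', rfl⟩ : ∃ M', M = M' + 1 := ⟨M - 1, by omega⟩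
  rw [Nat.mod_add_mod, Nat.add_sub_cancel, show M' * X + X = (M' + 1) * X by ring,
    Nat.mul_mod_right]

/-! ### Existence: every odd residue is `±5^t` -/

/-- Every odd `u` is `≡ ±5^t (mod 2^(n+2))` for some `t < 2^n`: the map `(ε, t) ↦ ε·5^t` from
`{±1} × [0, 2^n)` to `(ℤ/2^(n+2))ˣ` is injective between sets of size `2^(n+1) = φ(2^(n+2))`,
hence onto. [folklore] -/
theorem twoAdicLog_exists (n u : ℕ) (hu : Odd u) : ∃ t, t < 2 ^ n ∧
    (u % 2 ^ (n + 2) = 5 ^ t % 2 ^ (n + 2) ∨ (u + 5 ^ t) % 2 ^ (n + 2) = 0) := by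
  have h5 : Nat.Coprime 5 (2 ^ (n + 2)) := Nat.Coprime.pow_right _ (by norm_num)
  obtain ⟨g, hgv⟩ : ∃ g : (ZMod (2 ^ (n + 2)))ˣ, (g : ZMod (2 ^ (n + 2))) = 5 :=
    ⟨ZMod.unitOfCoprime 5 h5, by rw [ZMod.coe_unitOfCoprime, Nat.cast_ofNat]⟩
  let φ : Fin (2 ^ n) ⊕ Fin (2 ^ n) → (ZMod (2 ^ (n + 2)))ˣ :=
    Sum.elim (fun t => g ^ (t : ℕ)) (fun t => -g ^ (t : ℕ))
  have hinj : Function.Injective φ := by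
    rintro (t | t) (t' | t') h <;> have h' := congrArg Units.val h
    · simp only [φ, Sum.elim_inl, Units.val_pow_eq_pow_val, hgv] at h'
      rw [twoAdicLog_five_pow_eq_iff, Nat.mod_eq_of_lt t.isLt, Nat.mod_eq_of_lt t'.isLt] at h'
      rw [Fin.ext h']
    · simp only [φ, Sum.elim_inl, Sum.elim_inr, Units.val_neg, Units.val_pow_eq_pow_val, hgv] at h'
      exact absurd h' (twoAdicLog_five_pow_ne_neg n t t')
    · simp only [φ, Sum.elim_inl, Sum.elim_inr, Units.val_neg, Units.val_pow_eq_pow_val, hgv] at h'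
      exact absurd h'.symm (twoAdicLog_five_pow_ne_neg n t' t)
    · simp only [φ, Sum.elim_inr, Units.val_neg, Units.val_pow_eq_pow_val, hgv, neg_inj] at h'
      rw [twoAdicLog_five_pow_eq_iff, Nat.mod_eq_of_lt t.isLt, Nat.mod_eq_of_lt t'.isLt] at h'
      rw [Fin.ext h']
  have hcard : Fintype.card (Fin (2 ^ n) ⊕ Fin (2 ^ n)) = Fintype.card (ZMod (2 ^ (n + 2)))ˣ := by
    rw [Fintype.card_sum, Fintype.card_fin, ZMod.card_units_eq_totient,
      Nat.totient_prime_pow_succ Nat.prime_two, pow_succ]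
    omega
  have hbij := (Fintype.bijective_iff_injective_and_card φ).mpr ⟨hinj, hcard⟩
  have hcu : Nat.Coprime u (2 ^ (n + 2)) := Nat.Coprime.pow_right _ (Nat.coprime_two_right.mpr hu)
  obtain ⟨x, hx⟩ := hbij.2 (ZMod.unitOfCoprime u hcu)
  have hxv := congrArg Units.val hx
  rw [ZMod.coe_unitOfCoprime] at hxv
  rcases x with t | t
  · simp only [φ, Sum.elim_inl, Units.val_pow_eq_pow_val, hgv] at hxv
    exact ⟨t, t.isLt, Or.inl ((twoAdicLog_plus_iff _ _ _).mpr hxv.symm)⟩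
  · simp only [φ, Sum.elim_inr, Units.val_neg, Units.val_pow_eq_pow_val, hgv] at hxv
    exact ⟨t, t.isLt, Or.inr ((twoAdicLog_minus_iff _ _ _).mpr hxv.symm)⟩

/-! ### Consequences for a chosen logarithm `ind` -/

/-- Additivity on products of odd numbers, for any choice of logarithm below `2^n`. [folklore] -/
theorem twoAdicLog_hom_of_spec (n : ℕ) (ind : ℕ → ℕ) (hlt : ∀ u, ind u < 2 ^ n)
    (hspec : ∀ u, Odd u →
      u % 2 ^ (n + 2) = 5 ^ ind u % 2 ^ (n + 2) ∨ (u + 5 ^ ind u) % 2 ^ (n + 2) = 0)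
    (u v : ℕ) (hu : Odd u) (hv : Odd v) : ind (u * v) = (ind u + ind v) % 2 ^ n :=
  twoAdicLog_unique (hlt _) (Nat.mod_lt _ (by positivity)) (hspec _ (hu.mul hv))
    (twoAdicLog_pm_exp_congr (i := n) (by rw [Nat.mod_mod])
      (twoAdicLog_pm_mul (hspec u hu) (hspec v hv)))

/-- For `i ≤ n` and odd `w`, any choice of logarithm below `2^n` maps the class
`{u < 2^(n+2) : u ≡ w (mod 2^(i+2))}` bijectively onto `{t < 2^n : t ≡ ind w (mod 2^i)}`
(equality of sums). [folklore] -/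
theorem twoAdicLog_bij_of_spec (n : ℕ) (ind : ℕ → ℕ) (hlt : ∀ u, ind u < 2 ^ n)
    (hspec : ∀ u, Odd u →
      u % 2 ^ (n + 2) = 5 ^ ind u % 2 ^ (n + 2) ∨ (u + 5 ^ ind u) % 2 ^ (n + 2) = 0)
    (j : ℕ) (hj : 2 ≤ j) (hjn : j ≤ n + 2) (w : ℕ) (hw : Odd w) (g : ℕ → ℝ) :
    ∑ u ∈ (range (2 ^ (n + 2))).filter (fun u => u % 2 ^ j = w % 2 ^ j), g (ind u) =
      ∑ t ∈ (range (2 ^ n)).filter (fun t => t % 2 ^ (j - 2) = ind w % 2 ^ (j - 2)), g t := by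
  obtain ⟨i, rfl⟩ : ∃ i, j = i + 2 := ⟨j - 2, by omega⟩
  have hi : i ≤ n := by omega
  simp only [Nat.add_sub_cancel]
  have h4 : 4 ∣ 2 ^ (i + 2) := twoAdicLog_four_dvd i
  have h2 : 2 ∣ 2 ^ (i + 2) := ⟨2 ^ (i + 1), by ring⟩
  have hw2 := Nat.odd_iff.mp hw
  -- members of the class of `w` are odd
  have hodd : ∀ u, u % 2 ^ (i + 2) = w % 2 ^ (i + 2) → Odd u := by
    intro u hu
    rw [Nat.odd_iff, ← Nat.mod_mod_of_dvd u h2, hu, Nat.mod_mod_of_dvd w h2, hw2]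
  refine Finset.sum_nbij ind ?_ ?_ ?_ (fun _ _ => rfl)
  · -- maps the class into the progression
    intro u hu
    rw [Finset.mem_filter, Finset.mem_range] at hu ⊢
    exact ⟨hlt u, twoAdicLog_log_congr (twoAdicLog_pm_reduce hi (hspec u (hodd u hu.2)))
      (twoAdicLog_pm_reduce hi (hspec w hw)) hu.2⟩
  · -- injective on the class
    intro u hu u' hu' h
    rw [Finset.mem_coe, Finset.mem_filter, Finset.mem_range] at hu hu'
    have h4' : u % 4 = u' % 4 := by
      rw [← Nat.mod_mod_of_dvd u h4, hu.2, ← hu'.2, Nat.mod_mod_of_dvd _ h4]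
    have key := twoAdicLog_res_congr (i := n) (hspec u (hodd u hu.2)) (hspec u' (hodd u' hu'.2))
      (by rw [h]) h4'
    rwa [Nat.mod_eq_of_lt hu.1, Nat.mod_eq_of_lt hu'.1] at key
  · -- onto the progression
    intro t ht
    rw [Finset.mem_coe, Finset.mem_filter, Finset.mem_range] at ht
    -- a representative `u < 2^(n+2)` of `± 5^t`, with the sign of `w`
    obtain ⟨u, hu_lt, hu_pm, hu4⟩ : ∃ u, u < 2 ^ (n + 2) ∧
        (u % 2 ^ (n + 2) = 5 ^ t % 2 ^ (n + 2) ∨ (u + 5 ^ t) % 2 ^ (n + 2) = 0) ∧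
        u % 4 = w % 4 := by
      rcases hspec w hw with hw' | hw'
      · refine ⟨5 ^ t % 2 ^ (n + 2), Nat.mod_lt _ (by positivity), Or.inl (Nat.mod_mod _ _), ?_⟩
        rw [twoAdicLog_mod_four_of_plus hw',
          twoAdicLog_mod_four_of_plus (i := n) (Nat.mod_mod (5 ^ t) (2 ^ (n + 2)))]
      · have hrep := twoAdicLog_rep_minus (2 ^ (n + 2)) (5 ^ t) (by positivity)
        refine ⟨(2 ^ (n + 2) - 1) * 5 ^ t % 2 ^ (n + 2), Nat.mod_lt _ (by positivity),
          Or.inr hrep, ?_⟩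
        rw [twoAdicLog_mod_four_of_minus hw', twoAdicLog_mod_four_of_minus (i := n) hrep]
    refine ⟨u, ?_, twoAdicLog_unique (hlt u) ht.1 (hspec u (twoAdicLog_odd_of_pm hu_pm)) hu_pm⟩
    rw [Finset.mem_coe, Finset.mem_filter, Finset.mem_range]
    exact ⟨hu_lt, twoAdicLog_res_congr (twoAdicLog_pm_reduce hi hu_pm)
      (twoAdicLog_pm_reduce hi (hspec w hw)) ht.2 hu4⟩

/-- The statement of `stub_ind` at `k = n + 2`. [folklore] -/
theorem twoAdicLog_main (n : ℕ) : ∃ ind : ℕ → ℕ,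
    (∀ u, ind u < 2 ^ n) ∧
    (∀ u, ind (u % 2 ^ (n + 2)) = ind u) ∧
    (∀ u, Odd u → u % 2 ^ (n + 2) = 5 ^ ind u % 2 ^ (n + 2) ∨ (u + 5 ^ ind u) % 2 ^ (n + 2) = 0) ∧
    (∀ u v, Odd u → Odd v → ind (u * v) = (ind u + ind v) % 2 ^ n) ∧
    (∀ j, 2 ≤ j → j ≤ n + 2 → ∀ w, Odd w → ∀ g : ℕ → ℝ,
      ∑ u ∈ (range (2 ^ (n + 2))).filter (fun u => u % 2 ^ j = w % 2 ^ j), g (ind u) =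
        ∑ t ∈ (range (2 ^ n)).filter (fun t => t % 2 ^ (j - 2) = ind w % 2 ^ (j - 2)), g t) := by
  -- a logarithm for every residue (`0` on even residues)
  have hex : ∀ u, ∃ t, t < 2 ^ n ∧ (Odd u →
      (u % 2 ^ (n + 2) = 5 ^ t % 2 ^ (n + 2) ∨ (u + 5 ^ t) % 2 ^ (n + 2) = 0)) := by
    intro u
    by_cases hu : Odd u
    · obtain ⟨t, ht, h⟩ := twoAdicLog_exists n u hu
      exact ⟨t, ht, fun _ => h⟩
    · exact ⟨0, by positivity, fun h => absurd h hu⟩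
  choose lg hlg_lt hlg_pm using hex
  -- `ind u` is the logarithm of the residue of `u`
  obtain ⟨ind, hind⟩ : ∃ ind : ℕ → ℕ, ∀ u, ind u = lg (u % 2 ^ (n + 2)) := ⟨_, fun u => rfl⟩
  have hlt : ∀ u, ind u < 2 ^ n := fun u => by rw [hind]; exact hlg_lt _
  have h2 : 2 ∣ 2 ^ (n + 2) := ⟨2 ^ (n + 1), by ring⟩
  have hspec : ∀ u, Odd u →
      u % 2 ^ (n + 2) = 5 ^ ind u % 2 ^ (n + 2) ∨ (u + 5 ^ ind u) % 2 ^ (n + 2) = 0 := by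
    intro u hu
    have hu' : Odd (u % 2 ^ (n + 2)) := by
      rw [Nat.odd_iff] at hu ⊢
      rw [Nat.mod_mod_of_dvd u h2, hu]
    have h := hlg_pm (u % 2 ^ (n + 2)) hu'
    rwa [Nat.mod_mod, Nat.mod_add_mod, ← hind] at h
  exact ⟨ind, hlt, fun u => by rw [hind, hind, Nat.mod_mod], hspec,
    twoAdicLog_hom_of_spec n ind hlt hspec, twoAdicLog_bij_of_spec n ind hlt hspec⟩

/-- **Stub A (2-adic logarithm).** For `k ≥ 2` there is `ind : ℕ → ℕ`, `ind u < 2^(k−2)`,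
depending only on `u mod 2^k`, with `u ≡ ±5^(ind u) (mod 2^k)` for odd `u`, additive on products
of odd numbers modulo `2^(k−2)`, and such that for `2 ≤ j ≤ k` and odd `w` it maps the class
`{u < 2^k : u ≡ w (mod 2^j)}` bijectively onto the progression
`{t < 2^(k−2) : t ≡ ind w (mod 2^(j−2))}` (stated as an equality of sums).
Mathlib: `ZMod.orderOf_five`. [folklore] -/
theorem stub_ind (k : ℕ) (hk : 2 ≤ k) : ∃ ind : ℕ → ℕ,
    (∀ u, ind u < 2 ^ (k - 2)) ∧
    (∀ u, ind (u % 2 ^ k) = ind u) ∧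
    (∀ u, Odd u → u % 2 ^ k = 5 ^ ind u % 2 ^ k ∨ (u + 5 ^ ind u) % 2 ^ k = 0) ∧
    (∀ u v, Odd u → Odd v → ind (u * v) = (ind u + ind v) % 2 ^ (k - 2)) ∧
    (∀ j, 2 ≤ j → j ≤ k → ∀ w, Odd w → ∀ g : ℕ → ℝ,
      ∑ u ∈ (range (2 ^ k)).filter (fun u => u % 2 ^ j = w % 2 ^ j), g (ind u) =
        ∑ t ∈ (range (2 ^ (k - 2))).filter (fun t => t % 2 ^ (j - 2) = ind w % 2 ^ (j - 2)), g t) := by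
  obtain ⟨n, rfl⟩ : ∃ n, k = n + 2 := ⟨k - 2, by omega⟩
  simp only [Nat.add_sub_cancel]
  exact twoAdicLog_main n

end Summit.QuantumAdvantage.DigitPolyUniformity.SketchLAR.Chirp
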